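import Literature.MathematicalPhysics.QuantumFieldTheory.Balaban1983to89.B9Thm39Whole
import Literature.MathematicalPhysics.QuantumFieldTheory.Balaban1983to89.B6Prop23Chain
import Literature.MathematicalPhysics.QuantumFieldTheory.Balaban1983to89.B9Ineq349Whole

/-!
# `Balaban1983to89.B9Thm39WholeGeneric` — [B9] Theorem 3.9 (p. 413) as the whole printed leaf `B9.Thm39Printed` at the
# pinned datum `B9Thm39Whole.EK39OfOps`, and the kernel-summation leaf `B9.RWKernelSumYields`, with [4] Lemma 2.1 (2.61)
# consumed in its GENERIC-CONSTANT form `B6Lemma21Repaired.Ineq261With c` (resp. the family schema `B9Ineq349Whole.RowSum261`)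

T. Bałaban, *Propagators for lattice gauge theories in a background field*, Commun. Math. Phys. **99** (1985) 389–434
[`Balaban1985BackgroundPropagators`, "B9"]; [4] = T. Bałaban, *Propagators and renormalization transformations for lattice
gauge theories. II*, Commun. Math. Phys. **96** (1984) 223–250 [`Balaban1984PropagatorsII`].

statement-level skeleton of published theorems with citation tags; proofs where landed; nothing here is a claim about the
Yang–Mills mass gap

WHY THIS FILE.  The landed glue `B9Thm39Whole` (rows 15–16 of the N06 knit: `thm39Printed_of_local348`,
`rwKernelSumYields_EK39OfOps(_of_len)`) takes Lemma 2.1 (2.61) of [4] — p. 234: *"sup_{y∈𝔅} Σ_{y′∈𝔅} e^{−αδ₀d(y,y′)} ≤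
c₁(α), (2.61)"* — through the lineage `B9Thm39Sum` (`inverse_kernel_348_of_395`, `term399_majorant`) in the PRINTED-constant
form `B6RandomWalk.Ineq261 d g δ₀ α` (c₁(α) = 12c₀^d(½α) = `B6.c1 d δ₀ α`).  That constant is REFUTED AS TYPED for d ≧ 3
(`B6Lemma21Counterexample.printed_c1_exceeded`: d = 4, αδ₀ = ⅛; cell GAPS G-A11-1 — the last crossing leg of (2.47) pays no
separation factor), while every consumer uses (2.61) only as an α-dependent O(1); the geometry of record supplies (2.61) at
every rate with a GENERIC constant (`B9Ineq349Whole.RowSum261`, from `B6Lemma21ParamKLevelTorus.lemma21_torus_of_cond259`).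
So the knit's binder `h261` of rows 15–16 is un-dischargeable as landed.  THIS FILE re-derives the two lineage steps and the
glue with `B6.c1 d δ₀ α ↦ c`, `0 ≦ c` — exactly the tree's precedent `B6Prop26ChainGeneric` (*"RE-DERIVED FOR AN ARBITRARY
CONSTANT c IN THE ROW-SUM BOUND (2.61)"*) on the generic Neumann-series core `B6Prop23Chain.majorant_of_fixedPoint_266W`:

* §1 (3.96) generic: `rowSum_le_of_majorantWith`, `isUnit_one_sub_of_majorantWith`, `inverse_of_395With`,
  `inverse_kernel_348_of_395With` (= `B9Thm39Sum` §2 verbatim with c for c₁(r, α′); the located smallness M ≧ 2θ₀c).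
* §2 (3.99) generic: `term399_majorantWith` (`B9Thm37Sum.lchain_weight_le` is already generic in the constant).
* §3 at the letters `B9Thm39Whole.Ops39`: `conv348_of_local348With` (B₁ = 2NB₀c′, δ₁ = (1 − α′)r), `kterm_EK39OfOps_leWith`
  (O(M^{−1/2}) = (θ₀c + 1)M^{−1/2}), ★ `thm39Printed_of_local348With` — `B9.Thm39Printed d c35 geo bg (fun i => EK39OfOps (𝔬 i)
  (rd i) d (2NB₀c′) ((1 − α′)r))` with the two (2.61) inputs displayed as `Ineq261With c … δ₀ α ∧ Ineq261With c′ … r α′` for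
  M ≧ M_L, every other binder VERBATIM as in `thm39Printed_of_local348`; `thm39Printed_of_local348_of_with` (the landed v1
  theorem is the special case c = c₁(δ₀, α), c′ = c₁(r, α′): `B6Lemma21Repaired.ineq261_iff_with`).
* §4 fed by the family schema `RowSum261 geo` (n06-i; a THEOREM at the record geometry): ★ `thm39Printed_of_rowSum261`
  (∃ c′ ≧ 0, the leaf at the datum with B₁ = 2NB₀c′), ★ `thm39_and_kernelSum_of_rowSum261` (rows 15 AND 16 at ONE datum:
  `∃ c′, Thm39Printed … E ∧ RWKernelSumYields … E Cinv` for every carrier kernel reading the inverse, `KerReads`),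
  `thm32Printed_of_rowSum261` (*"This theorem implies Theorem 3.2"*).

HONEST SCOPE.  As in `B9Thm39Whole`: nothing of print is asserted — (3.48) for the C_□(U), the local inverse identities, the
smallness of R ([4] (2.83)–(2.85) by reference; cell GAPS G-B9-05 ∕ G-B9-07), the factor bounds (3.89), the locality inputs and
the static data are HYPOTHESES of printed shape; (2.61) is now a hypothesis with a free constant (or the schema `RowSum261`),
so that the record's torus Lemma 2.1 discharges it by name.  Value: kernel-checked bookkeeping; NOT a node discharge, NOT summit
progress; one finite 𝕋⁴ programme at fixed ε — nothing continuum, nothing about the mass gap.  Cell `pub-ymgap` (HUMAN RULING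
D-0062), Track A node N06 [B9], seat `pub-ymgap-dag-n06-j` (N06-ASSIGNMENT v1 rows 15–16, successor gen 2), 2026-08-26.
-/

namespace Literature.MathematicalPhysics.QuantumFieldTheory.Balaban1983to89.B9Thm39WholeGeneric

open Literature.MathematicalPhysics.QuantumFieldTheory.Balaban1983to89
open Finset B6RandomWalk B9Thm37Sum B9Thm34Ext B9Thm34Inv B9Thm39Sum B9Cor38Whole B9Thm39Whole B6Lemma21Repaired

/-! ## §1 (3.96) — «(Q′G′²Q′\*)⁻¹ = C₀(I − R)⁻¹ = Σ C₀Rⁿ» — with a GENERIC (2.61)-constant -/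

section Inversion

variable {g : B9.Geometry} [Fintype g.Site] [DecidableEq g.Site] {R : ℝ} {H : Prop}

/-- Row sums from a majorant θe^{−r·d(y,y′)} and (2.61) of [4] at the rate r, exponent α′ ≦ 1, with a GENERIC constant c in
place of c₁(r, α′): Σ_{y′}|E(δ_{y′})(y)| ≦ θc (`B9Thm34Inv.rowSum_le_of_majorant` with c₁ ↦ c).
[cite: Balaban1984PropagatorsII, (2.61) p.234 + (2.85)–(2.86) p.238] -/
theorem rowSum_le_of_majorantWith (c r α' θ : ℝ) (hθ : 0 ≤ θ) (hα' : α' ≤ 1) (hr : 0 ≤ r)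
    (hdnn : ∀ a b : g.Site, 0 ≤ g.dist a b) (h261 : Ineq261With c (toB6 g R H) r α')
    {E : Module.End ℝ (g.Site → ℝ)}
    (hE : HasMajorant (g := toB6 g R H) (fun x : g.Site => x) E (fun a b => θ * Real.exp (-(r * g.dist a b)))) :
    ∀ y : g.Site, ∑ y' : g.Site, |entry E y y'| ≤ θ * c := by
  intro y
  have h := (hasMajorant_id_iff (R := R) (H := H) _ _).mp hE
  calc ∑ y' : g.Site, |entry E y y'| ≤ ∑ y' : g.Site, θ * Real.exp (-(α' * r * g.dist y y')) := by
        refine Finset.sum_le_sum fun y' _ => (h y y').trans (mul_le_mul_of_nonneg_left ?_ hθ)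
        refine Real.exp_le_exp.mpr ?_
        have := mul_nonneg (mul_nonneg (sub_nonneg.mpr hα') hr) (hdnn y y')
        nlinarith
    _ = θ * ∑ y' : g.Site, Real.exp (-(α' * r * g.dist y y')) := by rw [Finset.mul_sum]
    _ ≤ θ * c := mul_le_mul_of_nonneg_left (h261 y) hθ

/-- *"the operator R is small"* ⇒ I − R is invertible, GENERIC constant: if R has the entry majorant θe^{−r·d(y,y′)}
((2.85)-shape), (2.61) of [4] holds at (r, α′) with constant c, α′ ≦ 1, and θc < 1, then I − R is invertible (row sums
≦ θc < 1, maximum principle on the finite set 𝔅: `B9Thm34Inv.isUnit_one_add_of_rowSum`).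
[cite: Balaban1985BackgroundPropagators, (3.96) p.411; Balaban1984PropagatorsII, (2.85)–(2.86) p.238] -/
theorem isUnit_one_sub_of_majorantWith (c r α' θ : ℝ) (hθ : 0 ≤ θ) (hα' : α' ≤ 1) (hr : 0 ≤ r)
    (hdnn : ∀ a b : g.Site, 0 ≤ g.dist a b) (h261 : Ineq261With c (toB6 g R H) r α')
    (hsmall : θ * c < 1) {Rop : Module.End ℝ (g.Site → ℝ)}
    (hR : HasMajorant (g := toB6 g R H) (fun x : g.Site => x) Rop (fun a b => θ * Real.exp (-(r * g.dist a b)))) :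
    IsUnit (1 - Rop) := by
  have hneg : HasMajorant (g := toB6 g R H) (fun x : g.Site => x) (-Rop)
      (fun a b => θ * Real.exp (-(r * g.dist a b))) := by
    rw [hasMajorant_id_iff] at hR ⊢
    intro y y'
    rw [entry_neg, abs_neg]
    exact hR y y'
  have h := isUnit_one_add_of_rowSum (-Rop) _ hsmall
    (rowSum_le_of_majorantWith (R := R) (H := H) c r α' θ hθ hα' hr hdnn h261 hneg)
  rwa [← sub_eq_add_neg] at h

/-- **(3.96), smallness and constants EXPLICIT, GENERIC (2.61)-constant** (entry form): L·C₀ = I − R ((3.95), `h395`), the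
(3.48)-majorant A·P(y)e^{−r·d(y,y′)} of C₀, the (2.85)-shape majorant θe^{−r·d(y,y′)} of R (*"By the same estimates as in [4],
especially (2.83)–(2.85), we can see that the operator R is small"*, by reference), Lemma 2.1 of [4] (2.61) at (r, α′) with
constant c ≧ 0, α′ ≦ 1, the metric facts, and θc < 1 ⇒ T (= C₀(I − R)⁻¹) with T·L = I = L·T, T·(I − R) = C₀, T = C₀ + T·R, and
the majorant A·c(1 − θc)⁻¹P(y)e^{−(1−α′)r·d(y,y′)} — *"The series is convergent in the weighted supremum norm on 𝔅 appearing in the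
inequality (3.48)"*, by [4] (2.64)–(2.66) run with a generic constant (`B6Prop23Chain.majorant_of_fixedPoint_266W`).
[cite: Balaban1985BackgroundPropagators, (3.95)–(3.96) p.411; Balaban1984PropagatorsII, (2.66) p.234 + Prop. 2.3 p.238] -/
theorem inverse_of_395With (c r α' θ A : ℝ) (P : g.Site → ℝ)
    (hA : 0 ≤ A) (hP : ∀ y, 0 ≤ P y) (hθ : 0 ≤ θ) (hc : 0 ≤ c) (hr : 0 ≤ r) (hα' : α' ≤ 1)
    (htri : Triangle254 (toB6 g R H)) (hrefl : ∀ y : g.Site, g.dist y y = 0)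
    (hdnn : ∀ a b : g.Site, 0 ≤ g.dist a b) (h261 : Ineq261With c (toB6 g R H) r α')
    (hsmall : θ * c < 1)
    {L C0 Rop : Module.End ℝ (g.Site → ℝ)} (h395 : L * C0 = 1 - Rop)
    (hC0 : HasMajorant (g := toB6 g R H) (fun x : g.Site => x) C0
      (fun a b => A * P a * Real.exp (-(r * g.dist a b))))
    (hR : HasMajorant (g := toB6 g R H) (fun x : g.Site => x) Rop
      (fun a b => θ * Real.exp (-(r * g.dist a b)))) :
    ∃ T : Module.End ℝ (g.Site → ℝ), T * L = 1 ∧ L * T = 1 ∧ T * (1 - Rop) = C0 ∧ T = C0 + T * Rop ∧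
      HasMajorant (g := toB6 g R H) (fun x : g.Site => x) T
        (fun a b => A * c * (1 - θ * c)⁻¹ * P a * Real.exp (-((1 - α') * r * g.dist a b))) := by
  obtain ⟨u, hu⟩ := isUnit_one_sub_of_majorantWith (R := R) (H := H) c r α' θ hθ hα' hr hdnn h261 hsmall hR
  have hLT : L * (C0 * ↑u⁻¹) = 1 := by
    rw [← mul_assoc, h395, ← hu, Units.mul_inv]
  have hTL : C0 * ↑u⁻¹ * L = 1 := mul_eq_one_symm hLT
  have hTR : C0 * ↑u⁻¹ * (1 - Rop) = C0 := by
    rw [mul_assoc, ← hu, Units.inv_mul, mul_one]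
  have hfix : C0 * ↑u⁻¹ = C0 + C0 * ↑u⁻¹ * Rop := by
    have h := hTR
    rw [mul_sub, mul_one, sub_eq_iff_eq_add] at h
    exact h
  refine ⟨C0 * ↑u⁻¹, hTL, hLT, hTR, hfix, ?_⟩
  have hαδ : 0 ≤ (1 - α') * r := mul_nonneg (sub_nonneg.mpr hα') hr
  have h263 : Ineq263With c (toB6 g R H) r α' := ineq263With_of_261With htri hr hα' h261
  exact B6Prop23Chain.majorant_of_fixedPoint_266W (g := toB6 g R H) (fun x : g.Site => x) c r α' θ A P hA hP hθ hc
    hαδ htri hrefl hdnn h261 h263 hsmall hC0 hR hfix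

/-- **(3.96) ⇒ (3.48) for (Q′G′²Q′\*)⁻¹ in the printed kernel notation, threshold and constants explicit, GENERIC
(2.61)-constant.**  With the kernels w.r.t. the pairing weight (L^{j′}η)^d (`B9Thm34Inv.ker (vol g d)`): if L·C₀ = I − R,
|C₀(y, y′)| ≦ A(L^jη)^{−4}(L^{j′}η)^{−d}e^{−r·d(y,y′)}, |R(y, y′)| ≦ θ₀M^{−1}(L^{j′}η)^{−d}e^{−r·d(y,y′)} ((2.85) of [4]), (2.61) of
[4] at (r, α′) with constant c ≧ 0, α′ ≦ 1, and **M ≧ 2θ₀c** (*"for M sufficiently large"*, located), then L has a two-sided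
inverse T = C₀(I − R)⁻¹ with |T(y, y′)| ≦ 2A·c·(L^jη)^{−4}(L^{j′}η)^{−d}e^{−(1−α′)r·d(y,y′)} — (3.48) with B₀ ↦ 2Ac, δ₀ ↦ (1 − α′)r.
(`B9Thm39Sum.inverse_kernel_348_of_395` with c₁(r, α′) ↦ c.)
[cite: Balaban1985BackgroundPropagators, (3.96) p.411 + Thm 3.2 (3.48) p.398; Balaban1984PropagatorsII, (2.85)–(2.87) p.238] -/
theorem inverse_kernel_348_of_395With (c : ℝ) (d : ℕ) (r α' θ₀ A : ℝ)
    (hc : 0 ≤ c) (hr : 0 ≤ r) (hα' : α' ≤ 1) (hθ₀ : 0 ≤ θ₀) (hA : 0 ≤ A) (hM : 0 < g.M)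
    (hMbig : 2 * θ₀ * c ≤ g.M)
    (htri : Triangle254 (toB6 g R H)) (hrefl : ∀ y : g.Site, g.dist y y = 0)
    (hdnn : ∀ a b : g.Site, 0 ≤ g.dist a b) (hlen : ∀ y : g.Site, 0 < g.len y)
    (h261 : Ineq261With c (toB6 g R H) r α')
    {L C0 Rop : Module.End ℝ (g.Site → ℝ)} (h395 : L * C0 = 1 - Rop)
    (hC0 : ∀ y y' : g.Site, |ker (vol g d) C0 y y'| ≤
      A * g.len y ^ (-(4 : ℝ)) * g.len y' ^ (-(d : ℝ)) * Real.exp (-(r * g.dist y y')))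
    (hRk : ∀ y y' : g.Site, |ker (vol g d) Rop y y'| ≤
      θ₀ * g.M⁻¹ * g.len y' ^ (-(d : ℝ)) * Real.exp (-(r * g.dist y y'))) :
    ∃ T : Module.End ℝ (g.Site → ℝ), T * L = 1 ∧ L * T = 1 ∧ T * (1 - Rop) = C0 ∧
      ∀ y y' : g.Site, |ker (vol g d) T y y'| ≤
        2 * A * c * g.len y ^ (-(4 : ℝ)) * g.len y' ^ (-(d : ℝ)) * Real.exp (-((1 - α') * r * g.dist y y')) := by
  set P : g.Site → ℝ := fun y => g.len y ^ (-(4 : ℝ)) with hPdef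
  set θ : ℝ := θ₀ * g.M⁻¹ with hθdef
  have hP : ∀ y, 0 < P y := fun y => Real.rpow_pos_of_pos (hlen y) _
  have hvol := vol_pos d hlen
  have hθ : 0 ≤ θ := mul_nonneg hθ₀ (inv_nonneg.mpr hM.le)
  -- the located smallness: θc ≤ 1/2 from M ≥ 2θ₀c
  have hθc : θ * c ≤ 1 / 2 := by
    rw [hθdef]
    have h1 : θ₀ * c ≤ g.M / 2 := by nlinarith
    calc θ₀ * g.M⁻¹ * c = θ₀ * c / g.M := by ring
      _ ≤ g.M / 2 / g.M := div_le_div_of_nonneg_right h1 hM.le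
      _ = 1 / 2 := by field_simp
  have hsmall : θ * c < 1 := by linarith
  -- the hypotheses in entry form
  have hC0e : HasMajorant (g := toB6 g R H) (fun x : g.Site => x) C0
      (fun a b => A * P a * Real.exp (-(r * g.dist a b))) := by
    refine (hasMajorant_id_iff _ _).mpr fun y y' => (ker_le_iff (vol g d) (hvol y') C0 y _).mp ?_
    refine (hC0 y y').trans (le_of_eq ?_)
    rw [vol_inv d hlen y']
    simp only [hPdef]
    ring
  have hRe : HasMajorant (g := toB6 g R H) (fun x : g.Site => x) Rop
      (fun a b => θ * Real.exp (-(r * g.dist a b))) := by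
    refine (hasMajorant_id_iff _ _).mpr fun y y' => (ker_le_iff (vol g d) (hvol y') Rop y _).mp ?_
    refine (hRk y y').trans (le_of_eq ?_)
    rw [vol_inv d hlen y', hθdef]
    ring
  obtain ⟨T, hTL, hLT, hTR, -, hmaj⟩ := inverse_of_395With (R := R) (H := H) c r α' θ A P hA (fun y => (hP y).le) hθ hc
    hr hα' htri hrefl hdnn h261 hsmall h395 hC0e hRe
  refine ⟨T, hTL, hLT, hTR, fun y y' => ?_⟩
  have hent := (hasMajorant_id_iff _ _).mp hmaj y y'
  have hinv : (1 - θ * c)⁻¹ ≤ 2 := by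
    rw [inv_le_comm₀ (by linarith) (by norm_num : (0 : ℝ) < 2)]
    linarith
  have hconst : A * c * (1 - θ * c)⁻¹ ≤ 2 * A * c := by
    calc A * c * (1 - θ * c)⁻¹ ≤ A * c * 2 := mul_le_mul_of_nonneg_left hinv (mul_nonneg hA hc)
      _ = 2 * A * c := by ring
  have hb : |entry T y y'| ≤ 2 * A * c * P y * Real.exp (-((1 - α') * r * g.dist y y')) := by
    refine hent.trans ?_
    have hrest : 0 ≤ P y * Real.exp (-((1 - α') * r * g.dist y y')) := mul_nonneg (hP y).le (Real.exp_nonneg _)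
    calc A * c * (1 - θ * c)⁻¹ * P y * Real.exp (-((1 - α') * r * g.dist y y'))
        = A * c * (1 - θ * c)⁻¹ * (P y * Real.exp (-((1 - α') * r * g.dist y y'))) := by ring
      _ ≤ 2 * A * c * (P y * Real.exp (-((1 - α') * r * g.dist y y'))) := mul_le_mul_of_nonneg_right hconst hrest
      _ = _ := by ring
  have hk := (ker_le_iff (vol g d) (hvol y') T y _).mpr hb
  refine hk.trans (le_of_eq ?_)
  rw [vol_inv d hlen y', hPdef]
  simp only
  ring

end Inversion

/-! ## §2 (3.99) — the bound of a walk term from factor majorants — with a GENERIC (2.61)-constant -/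

section Term399

variable {g : B9.Geometry} [Fintype g.Site] [DecidableEq g.Site] {R : ℝ} {H : Prop} {X : Type}

/-- **The (3.99)-shape bound of a walk term from factor majorants, GENERIC (2.61)-constant** (Corollary 3.8's mechanism
(3.91)–(3.94), p. 410): if the leading factor has the majorant 1_{S₀}(y)W₀(y)e^{−δ₀d(y,z)} (W₀ ≧ 0), the factors i ≧ 1 the
majorants 1_{Sᵢ}(y)θe^{−δ₀d(y,z)} (*"satisfies a bound of the type (3.89)"*), (2.61) of [4] holds at the exponent α with constant
c, and dω(y, y′) is an admissible lower bound of the path lengths through S₁, …, Sₙ ((3.93)), then the term has the majorant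
1_{S₀}(y)W₀(y)(θc)ⁿe^{−(1−α)δ₀dω(y,y′)} (`B9Thm39Sum.term399_majorant` with c₁(α) ↦ c; the chain estimate
`B9Thm37Sum.lchain_weight_le` is generic in the constant). [cite: Balaban1985BackgroundPropagators, Thm 3.9 (3.99) p.413 + Cor. 3.8 p.410] -/
theorem term399_majorantWith (blk : X → g.Site) (c δ₀ α θ : ℝ) (W₀ : g.Site → ℝ) (S : ℕ → Finset g.Site)
    (F : ℕ → Module.End ℝ (X → ℝ)) (dω : g.Site → g.Site → ℝ) (n : ℕ)
    (hW₀ : ∀ a, 0 ≤ W₀ a) (hθ : 0 ≤ θ) (hdnn : ∀ y y' : g.Site, 0 ≤ g.dist y y') (hαδ : 0 ≤ α * δ₀)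
    (h1αδ : 0 ≤ (1 - α) * δ₀) (h261 : Ineq261With c (toB6 g R H) δ₀ α)
    (hT0 : HasMajorant (g := toB6 g R H) blk (F 0)
      (fun (a b : g.Site) => if a ∈ S 0 then W₀ a * Real.exp (-(δ₀ * g.dist a b)) else 0))
    (hR : ∀ i, 1 ≤ i → i ≤ n → HasMajorant (g := toB6 g R H) blk (F i)
      (fun (a b : g.Site) => if a ∈ S i then θ * Real.exp (-(δ₀ * g.dist a b)) else 0))
    (hdω : ∀ a b : g.Site, LB g.dist S n a b (dω a b)) :
    HasMajorant (g := toB6 g R H) blk (lprod F n)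
      (fun (a b : g.Site) => (if a ∈ S 0 then W₀ a else 0) * (θ * c) ^ n *
        Real.exp (-((1 - α) * δ₀ * dω a b))) := by
  let w : ℕ → g.Site → ℝ := fun i a => if a ∈ S i then (if i = 0 then W₀ a else θ) else 0
  have hw0 : ∀ i a, 0 ≤ w i a := fun i a => by
    simp only [w]
    split_ifs
    · exact hW₀ a
    · exact hθ
    · exact le_rfl
  have hwΘ : ∀ i a, 1 ≤ i → w i a ≤ θ := fun i a hi => by
    have hi' : i ≠ 0 := by omega
    simp only [w, hi', if_false]
    split_ifs
    · exact le_rfl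
    · exact hθ
  have hwS : ∀ i a, 1 ≤ i → a ∉ S i → w i a = 0 := fun i a _ ha => by
    simp only [w, ha, if_false]
  have hK : ∀ i ≤ n, HasMajorant (g := toB6 g R H) blk (F i)
      (fun (a b : g.Site) => w i a * Real.exp (-(δ₀ * g.dist a b))) := by
    intro i hin
    by_cases hi : i = 0
    · subst hi
      refine hasMajorant_mono (g := toB6 g R H) blk hT0 fun a b => le_of_eq ?_
      simp only [w, if_true]
      split_ifs <;> ring
    · refine hasMajorant_mono (g := toB6 g R H) blk (hR i (by omega) hin) fun a b => le_of_eq ?_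
      simp only [w, hi, if_false]
      split_ifs <;> ring
  have hKnn : ∀ i ≤ n, ∀ (a b : g.Site), 0 ≤ w i a * Real.exp (-(δ₀ * g.dist a b)) := fun i _ a b =>
    mul_nonneg (hw0 i a) (Real.exp_nonneg _)
  have hprod := hasMajorant_lprod (G := toB6 g R H) blk F
    (fun i (a b : g.Site) => w i a * Real.exp (-(δ₀ * g.dist a b))) n hK hKnn
  refine hasMajorant_mono (g := toB6 g R H) blk hprod fun a b => ?_
  have hch := lchain_weight_le (St := g.Site) g.dist δ₀ α c θ hdnn hαδ h1αδ hθ h261 n S w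
    (fun i _ a => hw0 i a) (fun i hi _ a => hwΘ i a hi) (fun i hi _ a ha => hwS i a hi ha) a b (dω a b) (hdω a b)
  refine hch.trans (le_of_eq ?_)
  simp only [w, if_true]

end Term399

/-! ## §3 Theorem 3.9 at the letters `Ops39`, with (2.61) in the generic-constant form -/

section OneMember

variable {g : B9.Geometry} [Fintype g.Site] [DecidableEq g.Site] {B : B9.Backgrounds} {ι κ : Type} [Fintype ι]

/-- **THEOREM 3.9's FIRST CLAUSE AT ONE MEMBER AND ONE U — (3.96) ⇒ (3.48) for (Q′G′²Q′\*)⁻¹ — with (2.61) in the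
GENERIC-constant form.**  From: the static data (`StaticOK39`), (3.48) for the C_□(U) at (B₀, δ₀) (`Local348`; the rate
weakened to r ≦ δ₀), L_□C_□ = I (`Identities395`), the (2.85)-shape bound of R at (θ₀M⁻¹, r) (`Small285`), [4] Lemma 2.1 (2.61) at
(r, α′) WITH CONSTANT c′ ≧ 0 (`Ineq261With c′`), α′ ≦ 1, and «M sufficiently large» LOCATED as M ≧ 2θ₀c′: L(U) has a two-sided
inverse obeying (3.48) with **B₁ = 2NB₀c′, δ₁ = (1 − α′)r** — `Conv348 𝔬 d B₁ δ₁ U`.  (`B9Thm39Whole.conv348_of_local348` with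
c₁(r, α′) ↦ c′; route `c0_majorant`, `L_mul_C0_eq`, `inverse_kernel_348_of_395With`.)
[cite: Balaban1985BackgroundPropagators, (3.95)–(3.96) p.411 + Thm 3.2 (3.48) p.398; Balaban1984PropagatorsII, (2.85)–(2.87) p.238 + Lemma 2.1 (2.61) p.234] -/
theorem conv348_of_local348With (𝔬 : Ops39 g B ι κ) (R : ℝ) (H : Prop) (c' : ℝ) (d : ℕ) (r α' θ₀ B₀ δ₀ N : ℝ)
    (U : B.Cfg) (hc' : 0 ≤ c') (hr : 0 ≤ r) (hrδ : r ≤ δ₀) (hα' : α' ≤ 1) (hθ₀ : 0 ≤ θ₀) (hB₀ : 0 ≤ B₀) (hN : 0 ≤ N)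
    (hM : 0 < g.M) (hMbig : 2 * θ₀ * c' ≤ g.M) (hs : StaticOK39 𝔬 N) (h261 : Ineq261With c' (toB6 g R H) r α')
    (hl : Local348 𝔬 d B₀ δ₀ U) (hi : Identities395 𝔬 U) (hR : Small285 𝔬 d θ₀ r U) :
    Conv348 𝔬 d (2 * (N * B₀) * c') ((1 - α') * r) U := by
  have hlen : ∀ y : g.Site, 0 < g.len y := hs.lenpos
  have hvol := vol_pos d hlen
  have htri : Triangle254 (toB6 g R H) := fun a b e => hs.tri a b e
  -- (3.95)
  have h395 : 𝔬.L U * C0 𝔬 U = 1 - Rop 𝔬 U := L_mul_C0_eq 𝔬 U hs.hpu hs.hchi hi.inv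
  -- the (3.48)-majorants of the C_□(U) in entry form, at the weaker rate r
  have hC : ∀ i, HasMajorant (g := toB6 g R H) (fun x : g.Site => x) (𝔬.Cl U i)
      (fun (a b : g.Site) => B₀ * (g.len a ^ (-(4 : ℝ))) * Real.exp (-(r * g.dist a b))) := by
    intro i
    refine (hasMajorant_id_iff _ _).mpr fun a b => ?_
    have h1 : |entry (𝔬.Cl U i) a b| ≤ B₀ * g.len a ^ (-(4 : ℝ)) * Real.exp (-(δ₀ * g.dist a b)) := by
      refine (ker_le_iff (vol g d) (hvol b) (𝔬.Cl U i) a _).mp ?_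
      refine (hl.cl i a b).trans (le_of_eq ?_)
      rw [vol_inv d hlen b]
      ring
    refine h1.trans ?_
    have hexp : Real.exp (-(δ₀ * g.dist a b)) ≤ Real.exp (-(r * g.dist a b)) :=
      Real.exp_le_exp.mpr (by nlinarith [hs.dnn a b])
    exact mul_le_mul_of_nonneg_left hexp (mul_nonneg hB₀ (Real.rpow_nonneg (hlen a).le _))
  -- C₀ obeys (3.48) with NB₀ (localized sum)
  have hC0 := c0_majorant (R := R) (H := H) B₀ r N (fun y => g.len y ^ (-(4 : ℝ))) 𝔬.S 𝔬.h (fun i => 𝔬.Cl U i) hB₀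
    (fun y => Real.rpow_nonneg (hlen y).le _) hs.hh hs.hS hC hs.cnt
  have hC0k : ∀ y y' : g.Site, |ker (vol g d) (C0 𝔬 U) y y'| ≤
      N * B₀ * g.len y ^ (-(4 : ℝ)) * g.len y' ^ (-(d : ℝ)) * Real.exp (-(r * g.dist y y')) := by
    intro y y'
    have hent := (hasMajorant_id_iff _ _).mp hC0 y y'
    have hk := (ker_le_iff (vol g d) (hvol y') (C0 𝔬 U) y _).mpr hent
    refine hk.trans (le_of_eq ?_)
    rw [vol_inv d hlen y']
    ring
  obtain ⟨T, hTL, hLT, -, hb⟩ := inverse_kernel_348_of_395With (R := R) (H := H) c' d r α' θ₀ (N * B₀) hc' hr hα' hθ₀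
    (mul_nonneg hN hB₀) hM hMbig htri hs.refl hs.dnn hlen h261 h395 hC0k hR.rk
  exact ⟨T, hTL, hLT, hb⟩

/-- **THE BOUND (3.99) at one member and one configuration U, GENERIC (2.61)-constant** (p. 413: *"|(R′₀(X₀)R′_{α₁}(X₁)·⋯·
R′_{αₙ}(Xₙ))(y, y′)| ≦ O(1)(L^jη)^{−4}(L^{j′}η)^{−d}O(M^{−1/2})^{|ω|}M^{−½|ω|}e^{−½δ₀d(ω,y,y′)}"*) at the datum `EK39OfOps`, with O(1) = B₀,
O(M^{−1/2}) = (θ₀c + 1)M^{−1/2} and the rate ½·2(1 − α)δ₀: from (3.48) for C_{□₀}(U) (`Local348`), the (3.89)-type factor bounds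
(`Factors389`), (2.61) at α WITH CONSTANT c ≧ 0 (`Ineq261With c`) and the static data — by `term399_majorantWith`,
`B9Cor38Whole.LB_minLen` ((3.93)) and `B9.split_small_factor`.  (`B9Thm39Whole.kterm_EK39OfOps_le` with c₁(α) ↦ c.)
[cite: Balaban1985BackgroundPropagators, Thm 3.9 (3.99) p.413 + Cor. 3.8 (3.91)–(3.94) p.410 + (3.89) p.409; Balaban1984PropagatorsII, Lemma 2.1 (2.61) p.234] -/
theorem kterm_EK39OfOps_leWith (𝔬 : Ops39 g B ι κ) (rd : WalkReading39 B ι κ) (R : ℝ) (H : Prop) (c : ℝ) (d : ℕ)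
    (B₁ δ₁ δ₀ α θ₀ B₀ N : ℝ) (U : B.Cfg) (hc : 0 ≤ c) (hδ₀ : 0 ≤ δ₀) (hα : 0 ≤ α) (hα1 : α ≤ 1) (hθ₀ : 0 ≤ θ₀)
    (hB₀ : 0 ≤ B₀) (hM : 0 < g.M) (hs : StaticOK39 𝔬 N) (h261 : Ineq261With c (toB6 g R H) δ₀ α)
    (hl : Local348 𝔬 d B₀ δ₀ U) (hf : Factors389 𝔬 d θ₀ δ₀ U) (w : ℕ × ι × (ℕ → κ)) (y y' : g.Site) :
    |(EK39OfOps 𝔬 rd d B₁ δ₁).kterm U w y y'| ≤ g.len y ^ (-(4 : ℝ)) * g.len y' ^ (-(d : ℝ)) *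
      B9.walkFactor B₀ (θ₀ * c + 1) g.M (2 * ((1 - α) * δ₀)) ((EK39OfOps 𝔬 rd d B₁ δ₁).wlen w)
        ((EK39OfOps 𝔬 rd d B₁ δ₁).wdist w y y') := by
  obtain ⟨n, q, ω⟩ := w
  have hlen : ∀ z : g.Site, 0 < g.len z := hs.lenpos
  have hvol := vol_pos d hlen
  have hMinv : 0 ≤ g.M⁻¹ := inv_nonneg.mpr hM.le
  have hθ : 0 ≤ θ₀ * g.M⁻¹ := mul_nonneg hθ₀ hMinv
  have hαδ : 0 ≤ α * δ₀ := mul_nonneg hα hδ₀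
  have h1αδ : 0 ≤ (1 - α) * δ₀ := mul_nonneg (by linarith) hδ₀
  set S : ℕ → Finset g.Site := walkSets39 𝔬 q ω with hSdef
  set W₀ : g.Site → ℝ := fun a => B₀ * g.len a ^ (-(4 : ℝ)) with hW₀def
  have hW₀ : ∀ a, 0 ≤ W₀ a := fun a => mul_nonneg hB₀ (Real.rpow_nonneg (hlen a).le _)
  -- the head factor h_{□₀}C_{□₀}h_{□₀}: (3.48) for C_{□₀}, localized to S_{□₀}
  have hCq : HasMajorant (g := toB6 g R H) (fun x : g.Site => x) (𝔬.Cl U q)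
      (fun (a b : g.Site) => W₀ a * Real.exp (-(δ₀ * g.dist a b))) := by
    refine (hasMajorant_id_iff _ _).mpr fun a b => ?_
    refine (ker_le_iff (vol g d) (hvol b) (𝔬.Cl U q) a _).mp ?_
    refine (hl.cl q a b).trans (le_of_eq ?_)
    rw [vol_inv d hlen b, hW₀def]
    ring
  have hT0 : HasMajorant (g := toB6 g R H) (fun x : g.Site => x) (walkOps39 𝔬 U q ω 0)
      (fun (a b : g.Site) => if a ∈ S 0 then W₀ a * Real.exp (-(δ₀ * g.dist a b)) else 0) := by
    rw [walkOps39_zero]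
    have h := hasMajorant_sandwich_local (R := R) (H := H) (fun x : g.Site => x) hCq (𝔬.h q) (hs.hh q) (𝔬.S q) (hs.hS q)
    refine hasMajorant_mono (g := toB6 g R H) _ h fun a b => le_of_eq ?_
    rw [hSdef, walkSets39_zero]
  -- the factors R′_{α_k}(X_k), k ≥ 1: (3.89)-type bounds, localized to X_k ∩ 𝔅
  have hR : ∀ i, 1 ≤ i → i ≤ n → HasMajorant (g := toB6 g R H) (fun x : g.Site => x) (walkOps39 𝔬 U q ω i)
      (fun (a b : g.Site) => if a ∈ S i then θ₀ * g.M⁻¹ * Real.exp (-(δ₀ * g.dist a b)) else 0) := by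
    intro i hi _
    have hi0 : i ≠ 0 := by omega
    rw [walkOps39_of_ne 𝔬 U q ω hi0]
    refine (hasMajorant_id_iff _ _).mpr fun a b => ?_
    have hk := (ker_le_iff (vol g d) (hvol b) (𝔬.Rw U (ω i)) a
      ((if a ∈ 𝔬.Sw (ω i) then θ₀ * g.M⁻¹ else 0) * Real.exp (-(δ₀ * g.dist a b)))).mp (by
        refine (hf.rw (ω i) a b).trans (le_of_eq ?_)
        rw [vol_inv d hlen b]
        ring)
    refine hk.trans (le_of_eq ?_)
    rw [hSdef, walkSets39_of_ne 𝔬 q ω hi0]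
    split_ifs <;> ring
  -- the chain estimate (3.91)–(3.92) ⇒ (3.99)-shape majorant of the term, generic constant
  have hmaj := term399_majorantWith (R := R) (H := H) (fun x : g.Site => x) c δ₀ α (θ₀ * g.M⁻¹) W₀ S (walkOps39 𝔬 U q ω)
    (minLen g.dist S n) n hW₀ hθ hs.dnn hαδ h1αδ h261 hT0 hR (fun a b => LB_minLen g.dist n S a b)
  have hent := (hasMajorant_id_iff _ _).mp hmaj y y'
  have hk := (ker_le_iff (vol g d) (hvol y') (lprod (walkOps39 𝔬 U q ω) n) y _).mpr hent
  -- arithmetic: 1_{S₀}(y)W₀(y) ≤ B₀(L^jη)^{−4}; (θ₀M⁻¹c)ⁿ ≤ ((θ₀c + 1)M^{−1/2})ⁿM^{−n/2}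
  have hhead : (if y ∈ S 0 then W₀ y else 0) ≤ B₀ * g.len y ^ (-(4 : ℝ)) := by
    split_ifs
    · exact le_rfl
    · exact hW₀ y
  have hθc : θ₀ * g.M⁻¹ * c ≤ (θ₀ * c + 1) * g.M⁻¹ := by
    have h0 : 0 ≤ 1 * g.M⁻¹ := by rw [one_mul]; exact hMinv
    nlinarith
  have hpow : (θ₀ * g.M⁻¹ * c) ^ n ≤ ((θ₀ * c + 1) * g.M⁻¹) ^ n :=
    pow_le_pow_left₀ (mul_nonneg hθ hc) hθc n
  have hexp : Real.exp (-((1 - α) * δ₀ * minLen g.dist S n y y')) =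
      Real.exp (-(2 * ((1 - α) * δ₀) / 2 * minLen g.dist S n y y')) := by
    congr 1
    ring
  have hE : 0 ≤ Real.exp (-((1 - α) * δ₀ * minLen g.dist S n y y')) := Real.exp_nonneg _
  have hfac : (if y ∈ S 0 then W₀ y else 0) * (θ₀ * g.M⁻¹ * c) ^ n *
        Real.exp (-((1 - α) * δ₀ * minLen g.dist S n y y')) * (vol g d y')⁻¹ ≤
      g.len y ^ (-(4 : ℝ)) * g.len y' ^ (-(d : ℝ)) *
        B9.walkFactor B₀ (θ₀ * c + 1) g.M (2 * ((1 - α) * δ₀)) n (minLen g.dist S n y y') := by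
    rw [vol_inv d hlen y']
    have hvd : 0 ≤ g.len y' ^ (-(d : ℝ)) := Real.rpow_nonneg (hlen y').le _
    calc (if y ∈ S 0 then W₀ y else 0) * (θ₀ * g.M⁻¹ * c) ^ n *
          Real.exp (-((1 - α) * δ₀ * minLen g.dist S n y y')) * g.len y' ^ (-(d : ℝ))
        ≤ B₀ * g.len y ^ (-(4 : ℝ)) * ((θ₀ * c + 1) * g.M⁻¹) ^ n *
          Real.exp (-((1 - α) * δ₀ * minLen g.dist S n y y')) * g.len y' ^ (-(d : ℝ)) := by
          refine mul_le_mul_of_nonneg_right (mul_le_mul_of_nonneg_right ?_ hE) hvd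
          exact mul_le_mul hhead hpow (pow_nonneg (mul_nonneg hθ hc) n)
            (mul_nonneg hB₀ (Real.rpow_nonneg (hlen y).le _))
      _ = g.len y ^ (-(4 : ℝ)) * g.len y' ^ (-(d : ℝ)) *
          B9.walkFactor B₀ (θ₀ * c + 1) g.M (2 * ((1 - α) * δ₀)) n (minLen g.dist S n y y') := by
          rw [B9.split_small_factor (θ₀ * c + 1) g.M hM n, hexp]
          simp only [B9.walkFactor]
          ring
  show |ker (vol g d) (lprod (walkOps39 𝔬 U q ω) n) y y'| ≤ g.len y ^ (-(4 : ℝ)) * g.len y' ^ (-(d : ℝ)) *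
    B9.walkFactor B₀ (θ₀ * c + 1) g.M (2 * ((1 - α) * δ₀)) n (minLen g.dist (walkSets39 𝔬 q ω) n y y')
  rw [← hSdef]
  exact hk.trans hfac

end OneMember

/-! ## §3b ★ The whole printed leaf at the pinned datum, (2.61) with generic constants -/

section Family

variable {I : Type} {c35 : ℝ} {geo : I → B9.Geometry} {bg : I → B9.Backgrounds}
variable [∀ i, Fintype (geo i).Site] [∀ i, DecidableEq (geo i).Site]
variable {ι κ : I → Type} [∀ i, Fintype (ι i)]

/-- ★ **THEOREM 3.9 AS THE WHOLE PRINTED LEAF `B9.Thm39Printed`, (2.61) WITH GENERIC CONSTANTS** (p. 413: *"For M sufficiently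
large, and a configuration U satisfying (3.35), the operator Q′G′²Q′\* has an inverse which can be represented as (Q′G′²Q′\*)⁻¹ =
Σ_ω R′₀(X₀)R′_{α₁}(X₁)·⋯·R′_{αₙ}(Xₙ) (3.98) … (3.99)"*), INHABITED at the pinned datum `EK39OfOps (𝔬 i) (rd i) d B₁ δ₁` with B₁ =
2NB₀c′, δ₁ = (1 − α′)r — exactly `B9Thm39Whole.thm39Printed_of_local348` except that [4] Lemma 2.1 (2.61) enters at (δ₀, α) with a
GENERIC constant c ≧ 0 and at (r, α′) with a GENERIC constant c′ ≧ 0 (`B6Lemma21Repaired.Ineq261With`), for M ≧ M_L; the printed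
quantifiers are met with M₂ := max(M₁, M_L, 2θ₀c′), a₀ := a₁∕c35, the rate 2(1 − α)δ₀, O(1) := B₀, O(M^{−1/2}) := (θ₀c + 1)M^{−1/2}.
Every other input (`StaticOK39`, `Locality39`, and per U under M ≧ M₁, 0 < α₀, c35·Mα₀ ≦ a₁, (3.35): `Local348 ∧ Identities395 ∧
Small285 ∧ Factors389`) VERBATIM as in v1.  Nothing of print asserted; NOT a node discharge.
[cite: Balaban1985BackgroundPropagators, Thm 3.9 (3.98)–(3.99) p.413 + (3.95)–(3.96) p.411 + (3.35) p.396; Balaban1984PropagatorsII, Lemma 2.1 (2.61) p.234 + (2.83)–(2.87) p.238] -/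
theorem thm39Printed_of_local348With (𝔬 : ∀ i, Ops39 (geo i) (bg i) (ι i) (κ i))
    (rd : ∀ i, WalkReading39 (bg i) (ι i) (κ i)) (R : I → ℝ) (H : I → Prop) (c c' : ℝ) (d : ℕ)
    (α α' r δ₀ θ₀ B₀ N a₁ M₁ ML : ℝ)
    (hc : 0 ≤ c) (hc' : 0 ≤ c') (h35 : 0 < c35) (hα : 0 ≤ α) (hα1 : α < 1) (hα' : α' ≤ 1) (hr : 0 ≤ r) (hrδ : r ≤ δ₀)
    (hδ₀ : 0 < δ₀) (hθ₀ : 0 ≤ θ₀) (hB₀ : 0 < B₀) (hN : 0 ≤ N) (ha₁ : 0 < a₁) (hM₁ : 0 < M₁)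
    (hst : ∀ i, StaticOK39 (𝔬 i) N) (hloc : ∀ i, Locality39 (𝔬 i) (rd i))
    (h261 : ∀ i, ML ≤ (geo i).M →
      Ineq261With c (toB6 (geo i) (R i) (H i)) δ₀ α ∧ Ineq261With c' (toB6 (geo i) (R i) (H i)) r α')
    (h39 : ∀ i, M₁ ≤ (geo i).M → ∀ α₀ : ℝ, 0 < α₀ → c35 * (geo i).M * α₀ ≤ a₁ →
      ∀ U : (bg i).Cfg, (bg i).Reg335 c35 α₀ U →
        Local348 (𝔬 i) d B₀ δ₀ U ∧ Identities395 (𝔬 i) U ∧ Small285 (𝔬 i) d θ₀ r U ∧ Factors389 (𝔬 i) d θ₀ δ₀ U) :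
    B9.Thm39Printed d c35 geo bg
      (fun i => EK39OfOps (𝔬 i) (rd i) d (2 * (N * B₀) * c') ((1 - α') * r)) := by
  have hcpos : 0 < θ₀ * c + 1 := by
    have h0 : 0 ≤ θ₀ * c := mul_nonneg hθ₀ hc
    linarith
  refine ⟨max M₁ (max ML (2 * θ₀ * c')), a₁ / c35, 2 * ((1 - α) * δ₀), B₀, θ₀ * c + 1,
    lt_max_of_lt_left hM₁, div_pos ha₁ h35, by nlinarith, hB₀, hcpos, ?_⟩
  intro i hM α₀ hα₀ hMa U hU
  have hM₁i : M₁ ≤ (geo i).M := le_trans (le_max_left _ _) hM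
  have hMLi : ML ≤ (geo i).M := le_trans (le_trans (le_max_left _ _) (le_max_right _ _)) hM
  have hbig : 2 * θ₀ * c' ≤ (geo i).M := le_trans (le_trans (le_max_right _ _) (le_max_right _ _)) hM
  have hMpos : 0 < (geo i).M := lt_of_lt_of_le hM₁ hM₁i
  have ha : c35 * (geo i).M * α₀ ≤ a₁ := by
    have h1 : (geo i).M * α₀ * c35 ≤ a₁ := (le_div_iff₀ h35).mp hMa
    calc c35 * (geo i).M * α₀ = (geo i).M * α₀ * c35 := by ring
      _ ≤ a₁ := h1
  obtain ⟨hl, hi, hR, hf⟩ := h39 i hM₁i α₀ hα₀ ha U hU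
  obtain ⟨h261a, h261b⟩ := h261 i hMLi
  refine ⟨?_, fun w y y' => ⟨locDep_EK39OfOps (𝔬 i) (rd i) d _ _ (hloc i) U w, ?_⟩⟩
  · exact conv348_of_local348With (𝔬 i) (R i) (H i) c' d r α' θ₀ B₀ δ₀ N U hc' hr hrδ hα' hθ₀ hB₀.le hN hMpos hbig
      (hst i) h261b hl hi hR
  · exact kterm_EK39OfOps_leWith (𝔬 i) (rd i) (R i) (H i) c d _ _ δ₀ α θ₀ B₀ N U hc hδ₀.le hα hα1.le hθ₀ hB₀.le
      hMpos (hst i) h261a hl hf w y y'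

/-- Bookkeeping: the landed v1 leaf `B9Thm39Whole.thm39Printed_of_local348` IS the special case c = c₁(δ₀, α), c′ = c₁(r, α′) of
`thm39Printed_of_local348With` — the printed (2.61) is the generic form at c = `B6.c1` (`B6Lemma21Repaired.ineq261_iff_with`,
`Iff.rfl`), and c₁ ≧ 0 (`B6RandomWalk.c1_nonneg`). [cite: Balaban1984PropagatorsII, Lemma 2.1 (2.61) p.234] -/
theorem thm39Printed_of_local348_of_with (𝔬 : ∀ i, Ops39 (geo i) (bg i) (ι i) (κ i))
    (rd : ∀ i, WalkReading39 (bg i) (ι i) (κ i)) (R : I → ℝ) (H : I → Prop) (d : ℕ)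
    (α α' r δ₀ θ₀ B₀ N a₁ M₁ ML : ℝ)
    (h35 : 0 < c35) (hα : 0 ≤ α) (hα1 : α < 1) (hα' : α' ≤ 1) (hr : 0 ≤ r) (hrδ : r ≤ δ₀) (hδ₀ : 0 < δ₀)
    (hθ₀ : 0 ≤ θ₀) (hB₀ : 0 < B₀) (hN : 0 ≤ N) (ha₁ : 0 < a₁) (hM₁ : 0 < M₁)
    (hst : ∀ i, StaticOK39 (𝔬 i) N) (hloc : ∀ i, Locality39 (𝔬 i) (rd i))
    (h261 : ∀ i, ML ≤ (geo i).M →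
      Ineq261 d (toB6 (geo i) (R i) (H i)) δ₀ α ∧ Ineq261 d (toB6 (geo i) (R i) (H i)) r α')
    (h39 : ∀ i, M₁ ≤ (geo i).M → ∀ α₀ : ℝ, 0 < α₀ → c35 * (geo i).M * α₀ ≤ a₁ →
      ∀ U : (bg i).Cfg, (bg i).Reg335 c35 α₀ U →
        Local348 (𝔬 i) d B₀ δ₀ U ∧ Identities395 (𝔬 i) U ∧ Small285 (𝔬 i) d θ₀ r U ∧ Factors389 (𝔬 i) d θ₀ δ₀ U) :
    B9.Thm39Printed d c35 geo bg
      (fun i => EK39OfOps (𝔬 i) (rd i) d (2 * (N * B₀) * B6.c1 d r α') ((1 - α') * r)) :=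
  thm39Printed_of_local348With 𝔬 rd R H (B6.c1 d δ₀ α) (B6.c1 d r α') d α α' r δ₀ θ₀ B₀ N a₁ M₁ ML
    (c1_nonneg d δ₀ α) (c1_nonneg d r α') h35 hα hα1 hα' hr hrδ hδ₀ hθ₀ hB₀ hN ha₁ hM₁ hst hloc
    (fun i hM => ⟨(ineq261_iff_with d _ δ₀ α).mp (h261 i hM).1, (ineq261_iff_with d _ r α').mp (h261 i hM).2⟩) h39

end Family

/-! ## §4 ★ Rows 15 AND 16 fed by the family schema `RowSum261` — (2.61) at every rate, generic constant, M-threshold -/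

section RowSum

variable {I : Type} {c35 : ℝ} {geo : I → B9.Geometry} {bg : I → B9.Backgrounds}
variable [∀ i, Fintype (geo i).Site] [∀ i, DecidableEq (geo i).Site]
variable {ι κ : I → Type} [∀ i, Fintype (ι i)]

omit [∀ i, DecidableEq (geo i).Site] in
/-- From the family schema `B9Ineq349Whole.RowSum261 geo` (*"sup_{y∈𝔅} Σ_{y′∈𝔅} e^{−αδ₀d(y,y′)} ≤ c₁(α), (2.61)"* for *"RM
satisfying (2.59)"*, at EVERY rate with a generic constant and an M-threshold): the two (2.61) inputs of Theorem 3.9 at the rates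
αδ₀ and α′r, with ONE threshold and NONNEGATIVE constants. [cite: Balaban1984PropagatorsII, Lemma 2.1 (2.61) p.234 + (2.59) p.233] -/
theorem ineq261With_pair_of_rowSum261 (R : I → ℝ) (H : I → Prop) {α α' r δ₀ : ℝ} (hκ₁ : 0 < α * δ₀)
    (hκ₂ : 0 < α' * r) (hrow : B9Ineq349Whole.RowSum261 geo) :
    ∃ ML c c' : ℝ, 0 ≤ c ∧ 0 ≤ c' ∧ ∀ i, ML ≤ (geo i).M →
      Ineq261With c (toB6 (geo i) (R i) (H i)) δ₀ α ∧ Ineq261With c' (toB6 (geo i) (R i) (H i)) r α' := by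
  obtain ⟨ML₁, c₁, h₁⟩ := hrow (α * δ₀) hκ₁
  obtain ⟨ML₂, c₂, h₂⟩ := hrow (α' * r) hκ₂
  refine ⟨max ML₁ ML₂, max c₁ 0, max c₂ 0, le_max_right _ _, le_max_right _ _, fun i hM => ⟨fun y => ?_, fun y => ?_⟩⟩
  · exact (h₁ i (le_trans (le_max_left _ _) hM) y).trans (le_max_left _ _)
  · exact (h₂ i (le_trans (le_max_right _ _) hM) y).trans (le_max_left _ _)

/-- ★ **THEOREM 3.9 AS THE WHOLE PRINTED LEAF, [4] LEMMA 2.1 (2.61) SUPPLIED BY THE FAMILY SCHEMA `RowSum261 geo`** (a THEOREM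
at the geometry of record): for 0 < α < 1, 0 < α′ ≦ 1, 0 < r ≦ δ₀ and the inputs of `thm39Printed_of_local348With`, there is a
constant c′ ≧ 0 (from (2.61) at the rate α′r) such that `B9.Thm39Printed d c35 geo bg (fun i => EK39OfOps (𝔬 i) (rd i) d (2NB₀c′)
((1 − α′)r))`.  (The printed *"for M sufficiently large"* absorbs the (2.59)-threshold of the schema.)
[cite: Balaban1985BackgroundPropagators, Thm 3.9 (3.98)–(3.99) p.413; Balaban1984PropagatorsII, Lemma 2.1 (2.61) p.234] -/
theorem thm39Printed_of_rowSum261 (𝔬 : ∀ i, Ops39 (geo i) (bg i) (ι i) (κ i))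
    (rd : ∀ i, WalkReading39 (bg i) (ι i) (κ i)) (R : I → ℝ) (H : I → Prop) (d : ℕ)
    (α α' r δ₀ θ₀ B₀ N a₁ M₁ : ℝ)
    (h35 : 0 < c35) (hα : 0 < α) (hα1 : α < 1) (hα'0 : 0 < α') (hα' : α' ≤ 1) (hr : 0 < r) (hrδ : r ≤ δ₀)
    (hθ₀ : 0 ≤ θ₀) (hB₀ : 0 < B₀) (hN : 0 ≤ N) (ha₁ : 0 < a₁) (hM₁ : 0 < M₁)
    (hst : ∀ i, StaticOK39 (𝔬 i) N) (hloc : ∀ i, Locality39 (𝔬 i) (rd i))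
    (hrow : B9Ineq349Whole.RowSum261 geo)
    (h39 : ∀ i, M₁ ≤ (geo i).M → ∀ α₀ : ℝ, 0 < α₀ → c35 * (geo i).M * α₀ ≤ a₁ →
      ∀ U : (bg i).Cfg, (bg i).Reg335 c35 α₀ U →
        Local348 (𝔬 i) d B₀ δ₀ U ∧ Identities395 (𝔬 i) U ∧ Small285 (𝔬 i) d θ₀ r U ∧ Factors389 (𝔬 i) d θ₀ δ₀ U) :
    ∃ c' : ℝ, 0 ≤ c' ∧ B9.Thm39Printed d c35 geo bg
      (fun i => EK39OfOps (𝔬 i) (rd i) d (2 * (N * B₀) * c') ((1 - α') * r)) := by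
  have hδ₀ : 0 < δ₀ := lt_of_lt_of_le hr hrδ
  obtain ⟨ML, c, c', hc, hc', h261⟩ :=
    ineq261With_pair_of_rowSum261 (geo := geo) R H (mul_pos hα hδ₀) (mul_pos hα'0 hr) hrow
  exact ⟨c', hc', thm39Printed_of_local348With 𝔬 rd R H c c' d α α' r δ₀ θ₀ B₀ N a₁ M₁ ML hc hc' h35 hα.le hα1 hα'
    hr.le hrδ hδ₀ hθ₀ hB₀ hN ha₁ hM₁ hst hloc h261 h39⟩

/-- ★ **ROWS 15 AND 16 AT ONE DATUM FROM `RowSum261`**: Theorem 3.9 as the whole printed leaf AND the kernel-summation leaf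
`B9.RWKernelSumYields` (*"This theorem implies Theorem 3.2"*) at the SAME pinned datum `EK39OfOps … (2NB₀c′) ((1 − α′)r)`, for every
carrier kernel `Cinv` READING the inverse of L(U) = Q′G′²Q′\* (`B9Thm39Whole.KerReads`) — the convergence clause of the datum IS
(3.48) for the inverse (`Conv348`), with the constant weakened to max(B₁, 1) (`rwKernelSumYields_EK39OfOps_of_len`, needs L^jη > 0 =
`StaticOK39.lenpos` and 0 < (1 − α′)r).  So the knit may pin `(ops x).EK39` to ONE datum with B₁ a binder and take t39 ∧ hksum
from this conjunction. [cite: Balaban1985BackgroundPropagators, Thm 3.9 p.413 («This theorem implies Theorem 3.2») + Thm 3.2 (3.48) p.398; Balaban1984PropagatorsII, Lemma 2.1 (2.61) p.234] -/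
theorem thm39_and_kernelSum_of_rowSum261 (𝔬 : ∀ i, Ops39 (geo i) (bg i) (ι i) (κ i))
    (rd : ∀ i, WalkReading39 (bg i) (ι i) (κ i)) (Cinv : ∀ i, B9.SiteKernel (geo i) (bg i)) (R : I → ℝ)
    (H : I → Prop) (d : ℕ) (α α' r δ₀ θ₀ B₀ N a₁ M₁ : ℝ)
    (h35 : 0 < c35) (hα : 0 < α) (hα1 : α < 1) (hα'0 : 0 < α') (hα'1 : α' < 1) (hr : 0 < r) (hrδ : r ≤ δ₀)
    (hθ₀ : 0 ≤ θ₀) (hB₀ : 0 < B₀) (hN : 0 ≤ N) (ha₁ : 0 < a₁) (hM₁ : 0 < M₁)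
    (hst : ∀ i, StaticOK39 (𝔬 i) N) (hloc : ∀ i, Locality39 (𝔬 i) (rd i))
    (hrow : B9Ineq349Whole.RowSum261 geo) (hrd : ∀ i, KerReads (𝔬 i) (Cinv i) d)
    (h39 : ∀ i, M₁ ≤ (geo i).M → ∀ α₀ : ℝ, 0 < α₀ → c35 * (geo i).M * α₀ ≤ a₁ →
      ∀ U : (bg i).Cfg, (bg i).Reg335 c35 α₀ U →
        Local348 (𝔬 i) d B₀ δ₀ U ∧ Identities395 (𝔬 i) U ∧ Small285 (𝔬 i) d θ₀ r U ∧ Factors389 (𝔬 i) d θ₀ δ₀ U) :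
    ∃ c' : ℝ, 0 ≤ c' ∧
      B9.Thm39Printed d c35 geo bg (fun i => EK39OfOps (𝔬 i) (rd i) d (2 * (N * B₀) * c') ((1 - α') * r)) ∧
      B9.RWKernelSumYields d geo bg (fun i => EK39OfOps (𝔬 i) (rd i) d (2 * (N * B₀) * c') ((1 - α') * r)) Cinv := by
  obtain ⟨c', hc', h39P⟩ := thm39Printed_of_rowSum261 𝔬 rd R H d α α' r δ₀ θ₀ B₀ N a₁ M₁ h35 hα hα1 hα'0 hα'1.le hr
    hrδ hθ₀ hB₀ hN ha₁ hM₁ hst hloc hrow h39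
  have hδ₁ : 0 < (1 - α') * r := mul_pos (by linarith) hr
  exact ⟨c', hc', h39P, rwKernelSumYields_EK39OfOps_of_len 𝔬 rd Cinv d hδ₁ (fun i y => (hst i).lenpos y) hrd⟩

/-- **THEOREM 3.2 AS TYPED, from the Theorem-3.9 inputs with (2.61) supplied by `RowSum261`** (p. 413: *"This theorem implies
Theorem 3.2"* — the cell's `B9.thm32_of_thm39` at the datum of `thm39_and_kernelSum_of_rowSum261`): `B9.Thm32Printed d c35 geo bg Cinv`
for every carrier kernel reading the inverse. [cite: Balaban1985BackgroundPropagators, Thm 3.9 ⇒ Thm 3.2 p.413 + Thm 3.2 (3.48) p.398] -/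
theorem thm32Printed_of_rowSum261 (𝔬 : ∀ i, Ops39 (geo i) (bg i) (ι i) (κ i))
    (rd : ∀ i, WalkReading39 (bg i) (ι i) (κ i)) (Cinv : ∀ i, B9.SiteKernel (geo i) (bg i)) (R : I → ℝ)
    (H : I → Prop) (d : ℕ) (α α' r δ₀ θ₀ B₀ N a₁ M₁ : ℝ)
    (h35 : 0 < c35) (hα : 0 < α) (hα1 : α < 1) (hα'0 : 0 < α') (hα'1 : α' < 1) (hr : 0 < r) (hrδ : r ≤ δ₀)
    (hθ₀ : 0 ≤ θ₀) (hB₀ : 0 < B₀) (hN : 0 ≤ N) (ha₁ : 0 < a₁) (hM₁ : 0 < M₁)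
    (hst : ∀ i, StaticOK39 (𝔬 i) N) (hloc : ∀ i, Locality39 (𝔬 i) (rd i))
    (hrow : B9Ineq349Whole.RowSum261 geo) (hrd : ∀ i, KerReads (𝔬 i) (Cinv i) d)
    (h39 : ∀ i, M₁ ≤ (geo i).M → ∀ α₀ : ℝ, 0 < α₀ → c35 * (geo i).M * α₀ ≤ a₁ →
      ∀ U : (bg i).Cfg, (bg i).Reg335 c35 α₀ U →
        Local348 (𝔬 i) d B₀ δ₀ U ∧ Identities395 (𝔬 i) U ∧ Small285 (𝔬 i) d θ₀ r U ∧ Factors389 (𝔬 i) d θ₀ δ₀ U) :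
    B9.Thm32Printed d c35 geo bg Cinv := by
  obtain ⟨c', -, h39P, hks⟩ := thm39_and_kernelSum_of_rowSum261 𝔬 rd Cinv R H d α α' r δ₀ θ₀ B₀ N a₁ M₁ h35 hα hα1
    hα'0 hα'1 hr hrδ hθ₀ hB₀ hN ha₁ hM₁ hst hloc hrow hrd h39
  exact B9.thm32_of_thm39 d c35 geo bg _ Cinv h39P hks

end RowSum

end Literature.MathematicalPhysics.QuantumFieldTheory.Balaban1983to89.B9Thm39WholeGeneric
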